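import Mathlib
import Literature.Computability.Complexity.CNF
import Summits.PneNP.PneNP.Theses.OverlapGapAlgebra
import Summits.PneNP.PneNP.Theorems.OverlapGapAlgebraCruxesImplyTarget
import Summits.PneNP.PneNP.Theorems.OverlapGapAlgebraSolvableImpliesStableSectionEngine
import Summits.PneNP.PneNP.Theorems.OverlapGapAlgebraSolvableImpliesStableSectionAsymptotics

/-!
# Route OverlapGapAlgebra, crux `SolvableImpliesStableSection` (stmt-PneNP-2463), line `Sketch`:
# tightness of the transfer stub — it is FALSE without `IsPolyTime` (crux notes B1, via the engine)

Two results about the parked stub `stub_transfer` of `Lines/Sketch.lean` (efficient solvability ⇒ a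
typically-valid, average-stable pair `(g, G)` for all tolerances):
* `exists_oracleSolver`: ONE map `f* : List Bool → List Bool` (choice, no complexity claim) solves every
  satisfiable instance of every shape in the crux's input/output conventions; so the crux's hypothesis
  with `IsPolyTime` deleted holds wherever satisfiability has non-vanishing probability.
* `transfer_false_without_polyTime`: assuming the route's two known-fact cruxes `NoStableSection`
  (Bresler–Huang ensemble OGP, item 2462) and `PositiveSatProbability` (Achlioptas–Peres, item 2464),
  the IsPolyTime-free version of `stub_transfer` is FALSE: in the window `f*` makes its antecedent
  true, its consequent fed to the engine (`engine_count`, `stub_asymptotics` at rate `c/2`) gives the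
  path event with probability `≥ e^{-cn/2}` infinitely often, contradicting `NoStableSection`'s
  `≤ e^{-cn}` (`overlapGap_exp_sandwich_false`). Moral: any proof of `stub_transfer` must use the
  polynomial-time hypothesis essentially — no argument black-box in `f` can close the line.
-/

set_option linter.dupNamespace false -- `Summit.PneNP.PneNP.…`: summit = sub-problem (D-0017)

namespace Summit.PneNP.PneNP.Cruxes.SolvableImpliesStableSection.Sketch

open Finset
open scoped Classical

section OracleSolver
open Literature.Computability.Complexity

/-- Evaluation of the clause list of an instance `Φ` under a table `τ : ℕ → Bool`:
true iff every clause has a literal `(v, b)` with `τ v = b`. -/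
theorem os_eval_ofFn_iff {k m n : ℕ} (Φ : Fin m → Fin k → Fin n × Bool) (τ : ℕ → Bool) :
    CNF.eval (List.ofFn fun a => List.ofFn fun b => (((Φ a b).1 : ℕ), (Φ a b).2)) τ = true ↔
      ∀ a, ∃ b, τ ((Φ a b).1 : ℕ) = (Φ a b).2 := by
  rw [CNF.eval, List.all_eq_true]
  constructor
  · intro h a
    obtain ⟨l, hl, hval⟩ := List.any_eq_true.1 (h _ (List.mem_ofFn.2 ⟨a, rfl⟩))
    obtain ⟨b, rfl⟩ := List.mem_ofFn.1 hl
    exact ⟨b, by simpa [Literal.eval] using hval⟩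
  · intro h C hC
    obtain ⟨a, rfl⟩ := List.mem_ofFn.1 hC
    obtain ⟨b, hb⟩ := h a
    exact List.any_eq_true.2 ⟨_, List.mem_ofFn.2 ⟨b, rfl⟩, by simpa [Literal.eval] using hb⟩

/-- A bound exceeding every variable index occurring in a clause list. -/
theorem os_lt_bound (L : CNF ℕ) (C : Clause ℕ) (hC : C ∈ L) (l : Literal ℕ) (hl : l ∈ C) :
    l.1 < (L.map fun C => (C.map Prod.fst).foldr max 0).foldr max 0 + 1 := by
  have h1 : l.1 ≤ (C.map Prod.fst).foldr max 0 := by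
    have hmem : l.1 ∈ C.map Prod.fst := List.mem_map.2 ⟨l, hl, rfl⟩
    revert hmem
    generalize C.map Prod.fst = xs
    intro hmem
    induction xs with
    | nil => simp at hmem
    | cons x xs ih =>
      simp only [List.foldr_cons]
      rcases List.mem_cons.1 hmem with rfl | h
      · exact le_max_left _ _
      · exact (ih h).trans (le_max_right _ _)
  have h2 : (C.map Prod.fst).foldr max 0 ≤ (L.map fun C => (C.map Prod.fst).foldr max 0).foldr max 0 := by
    have hmem : (C.map Prod.fst).foldr max 0 ∈ L.map fun C => (C.map Prod.fst).foldr max 0 :=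
      List.mem_map.2 ⟨C, hC, rfl⟩
    revert hmem
    generalize (L.map fun C => (C.map Prod.fst).foldr max 0) = xs
    generalize (C.map Prod.fst).foldr max 0 = y
    intro hmem
    induction xs with
    | nil => simp at hmem
    | cons x xs ih =>
      simp only [List.foldr_cons]
      rcases List.mem_cons.1 hmem with rfl | h
      · exact le_max_left _ _
      · exact (ih h).trans (le_max_right _ _)
  omega

/-- **The oracle solver.** One map `f* : List Bool → List Bool` solving every satisfiable instance of
every `k`-SAT shape, in the input/output conventions of `SolvableImpliesStableSection`. -/
theorem exists_oracleSolver : ∃ fstar : List Bool → List Bool,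
    ∀ (k m n : ℕ) (Φ : Fin m → Fin k → Fin n × Bool),
      (∃ σ : Fin n → Bool, ∀ i, ∃ j, σ (Φ i j).1 = (Φ i j).2) →
      ∀ i, ∃ j, (fstar (encodingCNF.encode (List.ofFn fun a =>
        List.ofFn fun b => (((Φ a b).1 : ℕ), (Φ a b).2)))).getD (Φ i j).1 false = (Φ i j).2 := by
  -- `f* w` = a table of SOME satisfying assignment of the (unique) CNF encoded by `w`, if any
  let good : List Bool → Prop := fun w =>
    ∃ p : CNF ℕ × (ℕ → Bool), encodingCNF.encode p.1 = w ∧ p.1.eval p.2 = true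
  let fstar : List Bool → List Bool := fun w =>
    if h : good w then
      List.ofFn fun v : Fin ((h.choose.1.map fun C => (C.map Prod.fst).foldr max 0).foldr max 0 + 1) =>
        h.choose.2 v
    else []
  refine ⟨fstar, fun k m n Φ hsat i => ?_⟩
  set L : CNF ℕ := List.ofFn fun a => List.ofFn fun b => (((Φ a b).1 : ℕ), (Φ a b).2) with hL
  obtain ⟨σ, hσ⟩ := hsat
  -- the instance's code is `good`
  have hgood : good (encodingCNF.encode L) := by
    refine ⟨(L, fun v => if hv : v < n then σ ⟨v, hv⟩ else false), rfl, ?_⟩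
    rw [hL, os_eval_ofFn_iff]
    intro a
    obtain ⟨b, hb⟩ := hσ a
    exact ⟨b, by simpa using hb⟩
  -- the chosen CNF is `L` itself, and the chosen table satisfies it
  have hchooseL : hgood.choose.1 = L :=
    encodingCNF.encode_injective hgood.choose_spec.1
  have hchooseSat : ∀ a, ∃ b, hgood.choose.2 ((Φ a b).1 : ℕ) = (Φ a b).2 := by
    have h := hgood.choose_spec.2
    rw [hchooseL] at h
    exact (os_eval_ofFn_iff Φ _).1 h
  obtain ⟨j, hj⟩ := hchooseSat i
  refine ⟨j, ?_⟩
  have hf : fstar (encodingCNF.encode L) = List.ofFn fun v : Fin ((hgood.choose.1.map fun C =>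
      (C.map Prod.fst).foldr max 0).foldr max 0 + 1) => hgood.choose.2 v := by
    simp only [fstar, dif_pos hgood]
  have hlt : ((Φ i j).1 : ℕ) < (hgood.choose.1.map fun C => (C.map Prod.fst).foldr max 0).foldr max 0 + 1 := by
    rw [hchooseL]
    refine os_lt_bound L _ (by rw [hL]; exact List.mem_ofFn.2 ⟨i, rfl⟩) (((Φ i j).1 : ℕ), (Φ i j).2)
      (List.mem_ofFn.2 ⟨j, rfl⟩)
  rw [hf, List.getD_eq_getElem?_getD, List.getElem?_ofFn]
  simp [hlt, hj]

end OracleSolver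

/-! ## Tightness of the transfer stub: false without `IsPolyTime` (crux notes B1, through the engine) -/

/-- **The transfer stub is false without `IsPolyTime`** (given the two known-fact cruxes of the route).
If `NoStableSection` (Bresler–Huang's ensemble OGP, item 2462) and `PositiveSatProbability`
(Achlioptas–Peres, item 2464) hold, then the statement of `stub_transfer` with the hypothesis
`IsPolyTime f` DELETED is false: inside the window the oracle solver `f*` (`exists_oracleSolver`)
succeeds with probability `≥ Pr[satisfiable] ≥ ε`, so the IsPolyTime-free transfer would produce a
typically-valid average-stable `(g, G)` infinitely often, which the engine (`engine_count` +
`stub_asymptotics` at rate `c/2`) turns into the path event with probability `≥ e^{-cn/2}`, against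
`NoStableSection`'s `≤ e^{-cn}`. Moral (B1 made a theorem): every proof of `stub_transfer` must use the
polynomial-time hypothesis in an essential (non-black-box) way. -/
theorem transfer_false_without_polyTime
    (hNo : Summit.PneNP.PneNP.Theses.OverlapGapAlgebra.NoStableSection)
    (hPos : Summit.PneNP.PneNP.Theses.OverlapGapAlgebra.PositiveSatProbability) :
    ¬ (∀ k : ℕ, 3 ≤ k → ∀ α η ν : ℝ, 0 < α → 0 < η → 0 < ν →
      (∃ f : List Bool → List Bool, ∃ ε : ℝ, 0 < ε ∧ ∃ᶠ n : ℕ in Filter.atTop, ∀ m : ℕ, m = ⌊α * n⌋₊ → ε ≤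
        ((Finset.univ.filter fun Φ : Fin m → Fin k → Fin n × Bool => ∀ i, ∃ j,
          (f (Literature.Computability.Complexity.encodingCNF.encode (List.ofFn fun a =>
            List.ofFn fun b => (((Φ a b).1 : ℕ), (Φ a b).2)))).getD (Φ i j).1 false =
              (Φ i j).2).card : ℝ) / Fintype.card (Fin m → Fin k → Fin n × Bool)) →
      ∃ A : ℝ, 0 < A ∧ ∃ᶠ n : ℕ in Filter.atTop, ∀ m : ℕ, m = ⌊α * n⌋₊ →
        ∃ g : (Fin m → Fin k → Fin n × Bool) → (Fin n → Bool),
        ∃ G : Finset (Fin m → Fin k → Fin n × Bool),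
          (∀ Φ ∈ G, (((Finset.univ : Finset (Fin m)).filter fun i =>
              ∀ j, g Φ (Φ i j).1 ≠ (Φ i j).2).card : ℝ) ≤ ν * m) ∧
          ((k * m : ℕ) : ℝ) * (Gᶜ.card : ℝ) ≤ A * Fintype.card (Fin m → Fin k → Fin n × Bool) ∧
          (∑ a : Fin m, ∑ b : Fin k,
              (((Finset.univ : Finset ((Fin m → Fin k → Fin n × Bool) × (Fin n × Bool))).filter
                fun p => η * n < hammingDist (g p.1)
                  (g (Function.update p.1 a (Function.update (p.1 a) b p.2)))).card : ℝ))
            ≤ A * (Fintype.card (Fin m → Fin k → Fin n × Bool) * (2 * n))) := by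
  intro hT
  obtain ⟨k₀, hk₀⟩ := hNo
  obtain ⟨k₁, hk₁⟩ := hPos
  obtain ⟨k, hk0, hk1, hk3⟩ : ∃ k : ℕ, k₀ ≤ k ∧ k₁ ≤ k ∧ 3 ≤ k :=
    ⟨max (max k₀ k₁) 3, le_trans (le_max_left _ _) (le_max_left _ _),
      le_trans (le_max_right _ _) (le_max_left _ _), le_max_right _ _⟩
  obtain ⟨η, hη, ν, hν, c, hc, hevNo⟩ := hk₀ k hk0
  obtain ⟨ε, hε, hsat⟩ := hk₁ k hk1
  -- the window density
  have hkR : (1 : ℝ) < k := by exact_mod_cast (by omega : 1 < k)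
  have hα : (0 : ℝ) < 5 * 2 ^ k * Real.log k / k :=
    div_pos (mul_pos (mul_pos (by norm_num) (by positivity)) (Real.log_pos hkR)) (by linarith)
  -- the IsPolyTime-free hypothesis holds: the oracle solver succeeds whenever the instance is satisfiable
  obtain ⟨fstar, hfstar⟩ := exists_oracleSolver
  have hHyp : ∃ f : List Bool → List Bool, ∃ ε : ℝ, 0 < ε ∧ ∃ᶠ n : ℕ in Filter.atTop, ∀ m : ℕ,
      m = ⌊5 * 2 ^ k * Real.log k / k * n⌋₊ → ε ≤
        ((Finset.univ.filter fun Φ : Fin m → Fin k → Fin n × Bool => ∀ i, ∃ j,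
          (f (Literature.Computability.Complexity.encodingCNF.encode (List.ofFn fun a =>
            List.ofFn fun b => (((Φ a b).1 : ℕ), (Φ a b).2)))).getD (Φ i j).1 false =
              (Φ i j).2).card : ℝ) / Fintype.card (Fin m → Fin k → Fin n × Bool) := by
    refine ⟨fstar, ε, hε, Filter.Eventually.frequently (hsat.mono fun n hn m hm => ?_)⟩
    refine (hn m hm).trans (div_le_div_of_nonneg_right ?_ (Nat.cast_nonneg _))
    exact_mod_cast Finset.card_le_card fun Φ hΦ => by
      simp only [Finset.mem_filter, Finset.mem_univ, true_and] at hΦ ⊢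
      exact hfstar k m n Φ hΦ
  obtain ⟨A, hA, hfreq⟩ := hT k hk3 _ η ν hα hη hν hHyp
  have hk1' : 1 ≤ k := by omega
  have hasym := stub_asymptotics k hk1' (5 * 2 ^ k * Real.log k / k) A (c / 2) hα hA (half_pos hc)
  obtain ⟨n, ⟨hn, hasy⟩, hNo_n, hn1⟩ :=
    ((hfreq.and_eventually hasym).and_eventually (hevNo.and (Filter.eventually_ge_atTop 1))).exists
  generalize hm : ⌊5 * 2 ^ k * Real.log k / k * n⌋₊ = m at hn hNo_n hasy
  obtain ⟨g, G, hval, hG, hjump⟩ := hn _ rfl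
  have hE := engine_count k m n hn1 η A hη.le hA.le g G hG hjump
  have hNo' := hNo_n _ rfl g
  have hpaths : (Fintype.card (Fin (k + 1) → Fin m → Fin k → Fin n × Bool) : ℝ) =
      (2 * n) ^ (m * k * (k + 1)) := by
    rw [eng_card_paths]; push_cast; ring
  -- the engine's event implies the crux's event
  have hmono : ((univ : Finset (Fin (k + 1) → Fin m → Fin k → Fin n × Bool)).filter fun Ψ =>
          (∀ r : Fin k, ∀ q ≤ m * k,
            (fun (a : Fin m) (b : Fin k) =>
              if (a : ℕ) * k + b < q then Ψ r.succ a b else Ψ r.castSucc a b) ∈ G) ∧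
          ∀ r : Fin k, ∀ q < m * k,
            (hammingDist
              (g fun (a : Fin m) (b : Fin k) =>
                if (a : ℕ) * k + b < q then Ψ r.succ a b else Ψ r.castSucc a b)
              (g fun (a : Fin m) (b : Fin k) =>
                if (a : ℕ) * k + b < q + 1 then Ψ r.succ a b else Ψ r.castSucc a b) : ℝ)
              ≤ η * n).card ≤
      ((univ : Finset (Fin (k + 1) → Fin m → Fin k → Fin n × Bool)).filter fun Ψ =>
        let P : Fin k → ℕ → Fin m → Fin k → Fin n × Bool :=
          fun r q a b => if (a : ℕ) * k + b < q then Ψ r.succ a b else Ψ r.castSucc a b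
        (∀ r : Fin k, ∀ q ≤ m * k, (((Finset.univ : Finset (Fin m)).filter fun i =>
          ∀ j, g (P r q) (P r q i j).1 ≠ (P r q i j).2).card : ℝ) ≤ ν * m) ∧
        ∀ r : Fin k, ∀ q < m * k,
          (hammingDist (g (P r q)) (g (P r (q + 1))) : ℝ) ≤ η * n).card := by
    refine Finset.card_le_card fun Ψ hΨ => ?_
    simp only [Finset.mem_filter, Finset.mem_univ, true_and] at hΨ ⊢
    obtain ⟨hin, hjmp⟩ := hΨ
    exact ⟨fun r q hq => hval _ (hin r q hq), fun r q hq => hjmp r q hq⟩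
  have hmono' := (Nat.cast_le (α := ℝ)).2 hmono
  haveI : Nonempty (Fin n × Bool) := ⟨(⟨0, hn1⟩, false)⟩
  refine Summit.PneNP.PneNP.Theorems.overlapGap_exp_sandwich_false (c := c) (n := n) hc hn1
    (Ω := Fin (k + 1) → Fin m → Fin k → Fin n × Bool) (x := _) ?_ hNo'
  rw [hpaths]
  linarith [hasy, hE, hmono']

end Summit.PneNP.PneNP.Cruxes.SolvableImpliesStableSection.Sketch
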